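import Summits.HubbardSuperconductivity.HubbardLadder.Bounds.ThermalMottCDWCeilingGlue
import HarnessLib

/-!
# Hubbard ladder — Bounds: directional kinetic positivity in a sector (bounds cell, REQUEST #179.1)

HONEST FRAMING. Ladder R1–R4 with certified numbers; no claim on `H/H₀`. Bounds for model classes
(the nearest-neighbour Hubbard Hamiltonian on the torus `(ℤ/L)²`), no materials claim.

THE POINT. Kubo–Kishi's sharp structure-factor ceilings at a general wave vector `q` (KK90 Thms 1–2,
`C_q ∝ E_q`, `E_q = Σ_i (1 - cos q_i)`; `paper/bounds.tex` Thm 11, middle forms of (A3)/(B3)) trade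
the `q`-weighted double commutator for the total kinetic energy using translation AND rotation
invariance of the Gibbs state. A fixed `(N↑, N↓)` sector of a finite torus has neither in the tree
(fermionic translations carry Jordan–Wigner signs). Substitute proved here, for
`H = -t T(1) + U D - μ N` (`hamiltonianWith`) on `(ℤ/L)²`, ANY real `t, U, μ`, `β > 0` and ANY
principal block `p` (every particle-number sector in particular):

  `t · Re ⟨T(1_{dir j})|_p⟩_{β, H|_p} ≥ 0` for each lattice direction `j`     (Prop. 11.5,
  `re_gibbsState_dirHopping_toBlock_nonneg`; node `DirectionalKineticPositivity`).

Proof: Bogoliubov convexity twice, `Re⟨W⟩_{A+W} ≤ Re⟨W⟩_A` (`re_gibbsState_add_le`) with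
`W = -t T_j|_p`, `A = (-t T_{1-j} + U D - μ N)|_p`, and `tr (e^{-βA|_p} T_j|_p) = 0`
(`trace_gibbsWeight_rest_mul_dirHopping_toBlock`): each bond term `c†_{uσ} c_{vσ}` of `T_j` is
rescaled by `e^{-1} ≠ 1` under the Koma–Tasaki site gauge of the indicator of the coordinate-`j` class
of `u`, which leaves `A` invariant, and a conjugation commuting with `e^{-βA|_p}` with a non-unit
eigenvalue kills the trace (`trace_mul_eq_zero_of_conj_eq_smul`; the gauge is diagonal, so it
commutes with the compression to `p`). Consequence (#179.2 `ThermalStructureFactorCeilingCanonicalQ`, `re_gibbsState_hoppingForm_dirWeighted_toBlock_le`):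
for direction weights `ε_j ≤ ε_max`, `t Re⟨T(Σ_j ε_j 1_{dir j})|_p⟩ ≤ ε_max · t Re⟨T(1)|_p⟩
= ε_max ⟨-H_kin|_p⟩` — the step Kubo–Kishi take by symmetry (proof of Thm 1), here WITHOUT symmetry.

References: KuboKishi1990 (Thms 1–2, Remarks 1–3); KomaTasakiPRL1992 eqs. (5)–(8) (site gauge);
DLS1978 §2 (Bogoliubov convexity); this cell #177 (band bound, all `q`), #174/#173 (`q = Q`).
Presearch (corpus fts+vec AND galaxy, 2026-08-21): no directional kinetic-positivity statement for
Hubbard sectors found; nearest KK90 p.122 (symmetry step). Grade: VARIANT (known tools, new use).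
-/

namespace Summit.HubbardSuperconductivity.HubbardLadder.Bounds

open Matrix Finset Real
open Literature.MathematicalPhysics.QuantumLattice
open Literature.Probability.LatticeModels
open scoped ComplexOrder ComplexConjugate

/-! ### Two abstract facts: Bogoliubov monotonicity and trace killing by a commuting conjugation -/

section Abstract

variable {n : Type*} [Fintype n]

/-- **Bogoliubov convexity, twice**: for Hermitian `A`, `W` and `β > 0`,
`Re⟨W⟩_{β, A+W} ≤ Re⟨W⟩_{β, A}` (the free energy is concave along `s ↦ A + sW`). -/
theorem re_gibbsState_add_le [DecidableEq n] [Nonempty n] {A W : Matrix n n ℂ} (hA : A.IsHermitian)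
    (hW : W.IsHermitian) {β : ℝ} (hβ : 0 < β) :
    (gibbsState β (A + W) W).re ≤ (gibbsState β A W).re := by
  have h1 := log_partitionFn_sub_le_log_partitionFn_add hA hW β
  have h2 := log_partitionFn_sub_le_log_partitionFn_add (hA.add hW) hW.neg β
  rw [add_neg_cancel_right, map_neg, Complex.neg_re] at h2
  by_contra h
  have h3 := mul_pos hβ (sub_pos.2 (lt_of_not_ge h))
  rw [mul_sub] at h3
  linarith

/-- **A conjugation commuting with `E` that rescales `X` by `c ≠ 1` kills `tr (E X)`**:
`S' S = 1`, `S E = E S`, `S X S' = c X` ⟹ `tr (E X) = 0`. -/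
theorem trace_mul_eq_zero_of_conj_eq_smul {inst : DecidableEq n} {S S' X E : Matrix n n ℂ} {c : ℂ}
    (hS : S' * S = 1) (hE : S * E = E * S) (hX : S * X * S' = c • X) (hc : c ≠ 1) :
    trace (E * X) = 0 := by
  have h : trace (E * X) = c * trace (E * X) :=
    calc trace (E * X) = trace (S' * (S * (E * X))) := by rw [← Matrix.mul_assoc, hS, Matrix.one_mul]
      _ = trace (S * (E * X) * S') := trace_mul_comm _ _
      _ = trace (E * (S * X * S')) := by
        rw [← Matrix.mul_assoc S E X, hE, Matrix.mul_assoc E S X, Matrix.mul_assoc E (S * X) S']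
      _ = c * trace (E * X) := by rw [hX, Matrix.mul_smul, trace_smul, smul_eq_mul]
  have h' : (1 - c) * trace (E * X) = 0 := by rw [sub_mul, one_mul, ← h, sub_self]
  exact (mul_eq_zero.1 h').resolve_left (sub_ne_zero.2 hc.symm)

/-- A matrix commuting with `A` commutes with the Gibbs weight `e^{-βA}`. -/
theorem mul_gibbsWeight_comm [DecidableEq n] {S A : Matrix n n ℂ} (h : S * A = A * S) (β : ℝ) :
    S * gibbsWeight β A = gibbsWeight β A * S :=
  (((show Commute S A from h).smul_right (-(β : ℂ))).exp_right).eq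

/-- `S' S = 1` and `S A S' = A` give `S A = A S` (stated for an arbitrary decidability instance, so that
it applies verbatim to equations imported from files elaborated with another instance path). -/
theorem mul_eq_mul_of_conj_eq {inst : DecidableEq n} {S S' A : Matrix n n ℂ} (hS : S' * S = 1)
    (hA : S * A * S' = A) : S * A = A * S :=
  calc S * A = S * A * (S' * S) := by rw [hS, Matrix.mul_one]
    _ = S * A * S' * S := by rw [← Matrix.mul_assoc]
    _ = A * S := by rw [hA]

/-- **Compression of a product whose left factor has no upper-right block**:
`(A B)|_p = A|_p B|_p` if `A i j = 0` for `p i`, `¬ p j`. -/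
theorem toBlock_mul_eq_of_upperRight (p : n → Prop) [DecidablePred p] {A : Matrix n n ℂ}
    (B : Matrix n n ℂ) (hA : ∀ i, p i → ∀ j, ¬p j → A i j = 0) :
    (A * B).toBlock p p = A.toBlock p p * B.toBlock p p := by
  rw [toBlock_mul_eq_add p p p A B]
  have h0 : (A.toBlock p fun j => ¬p j) = 0 := by
    ext i j; exact hA i i.2 j j.2
  rw [h0, Matrix.zero_mul, add_zero]

/-- **Compression of a product whose right factor has no lower-left block**:
`(A B)|_p = A|_p B|_p` if `B i j = 0` for `¬ p i`, `p j`. -/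
theorem toBlock_mul_eq_of_lowerLeft (p : n → Prop) [DecidablePred p] (A : Matrix n n ℂ)
    {B : Matrix n n ℂ} (hB : ∀ i, ¬p i → ∀ j, p j → B i j = 0) :
    (A * B).toBlock p p = A.toBlock p p * B.toBlock p p := by
  rw [toBlock_mul_eq_add p p p A B]
  have h0 : (B.toBlock (fun j => ¬p j) p) = 0 := by
    ext i j; exact hB i i.2 j j.2
  rw [h0, Matrix.mul_zero, add_zero]

/-- If `S' S = 1` and `S'` has no upper-right block then `S'|_p S|_p = 1` (stated for an arbitrary
decidability instance, cf. `mul_eq_mul_of_conj_eq`). -/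
theorem toBlock_mul_toBlock_eq_one {inst : DecidableEq n} (p : n → Prop) [DecidablePred p]
    {S S' : Matrix n n ℂ} (hS : S' * S = 1) (hS' : ∀ i, p i → ∀ j, ¬p j → S' i j = 0) :
    S'.toBlock p p * S.toBlock p p = 1 := by
  rw [← toBlock_mul_eq_of_upperRight p S hS', hS, toBlock_one_self]

end Abstract

/-! ### The site gauge is diagonal -/

section Gauge

variable {Λ : Type*} [LinearOrder Λ] [Fintype Λ]

omit [Fintype Λ] in
/-- Off-diagonal entries of the Koma–Tasaki site gauge vanish. -/
theorem siteGauge_apply_ne (φ : Λ → ℝ) {i j : Finset (Orb Λ)} (hij : i ≠ j) : siteGauge φ i j = 0 := by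
  rw [siteGauge_eq, gaugeMatrix_eq, diagonal_apply_ne _ hij]

end Gauge

/-! ### Direction classes of bonds on the torus `(ℤ/L)²` -/

section Torus

variable {L : ℕ} [NeZero L]

/-- The nearest-neighbour torus graph on `FermionTorus 2 L`. -/
local notation "Gᴸ" => fermionTorusGraph 2 L

/-- The indicator (as a real bond weight) of "`u` and `v` differ exactly in coordinate `j`":
on a bond of the torus this says the bond points in direction `j`. -/
noncomputable def dirWeight (j : Fin 2) (u v : FermionTorus 2 L) : ℝ :=
  if u.toTorusSite j ≠ v.toTorusSite j ∧ ∀ k, k ≠ j → u.toTorusSite k = v.toTorusSite k then 1 else 0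

omit [NeZero L] in
/-- `dirWeight` is symmetric. -/
theorem dirWeight_symm (j : Fin 2) (u v : FermionTorus 2 L) : dirWeight j u v = dirWeight j v u := by
  unfold dirWeight
  by_cases h : u.toTorusSite j ≠ v.toTorusSite j ∧ ∀ k, k ≠ j → u.toTorusSite k = v.toTorusSite k
  · rw [if_pos h, if_pos ⟨fun e => h.1 e.symm, fun k hk => (h.2 k hk).symm⟩]
  · rw [if_neg h, if_neg fun hc => h ⟨fun e => hc.1 e.symm, fun k hk => (hc.2 k hk).symm⟩]

omit [NeZero L] in
/-- `dirWeight` takes the values `0`, `1`. -/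
theorem dirWeight_eq_zero_or_one (j : Fin 2) (u v : FermionTorus 2 L) :
    dirWeight j u v = 0 ∨ dirWeight j u v = 1 := by
  unfold dirWeight; split_ifs <;> simp

omit [NeZero L] in
/-- If `dirWeight j u v ≠ 0` then `u`, `v` differ in coordinate `j` and agree elsewhere. -/
theorem ne_and_eq_of_dirWeight_ne_zero {j : Fin 2} {u v : FermionTorus 2 L} (h : dirWeight j u v ≠ 0) :
    u.toTorusSite j ≠ v.toTorusSite j ∧ ∀ k, k ≠ j → u.toTorusSite k = v.toTorusSite k := by
  by_contra hc; exact h (by rw [dirWeight, if_neg hc])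

omit [NeZero L] in
/-- **On a bond of the torus exactly one direction weight is `1`**: `Σ_j 1_{dir j}(u,v) = 1` for
`u ∼ v`. -/
theorem sum_dirWeight_of_adj {u v : FermionTorus 2 L} (h : (Gᴸ).Adj u v) :
    ∑ j, dirWeight j u v = 1 := by
  rw [fermionTorusGraph_adj, torusGraph_adj_iff] at h
  obtain ⟨hne, hex⟩ := h
  -- in both orientations: the sites differ exactly in one coordinate `i`
  have key : ∃ i : Fin 2, ∀ k, k ≠ i → u.toTorusSite k = v.toTorusSite k := by
    rcases hex with ⟨i, hi⟩ | ⟨i, hi⟩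
    · exact ⟨i, fun k hk => by rw [hi, Pi.add_apply, Pi.single_eq_of_ne hk, add_zero]⟩
    · exact ⟨i, fun k hk => by rw [hi, Pi.add_apply, Pi.single_eq_of_ne hk, add_zero]⟩
  obtain ⟨i, hk⟩ := key
  have hii : u.toTorusSite i ≠ v.toTorusSite i := by
    intro e
    refine hne (funext fun k => ?_)
    by_cases hk' : k = i
    · rw [hk']; exact e
    · exact hk k hk'
  have hw : ∀ j, dirWeight j u v = if j = i then 1 else 0 := by
    intro j
    by_cases hj : j = i
    · subst hj; rw [if_pos rfl, dirWeight, if_pos ⟨hii, hk⟩]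
    · rw [if_neg hj, dirWeight, if_neg fun hc => hc.1 (hk j hj)]
  simp only [hw, Finset.sum_ite_eq', Finset.mem_univ, if_true]

omit [NeZero L] in
/-- **`T(1) = Σ_j T(1_{dir j})`**: the kinetic hopping form splits over the bond directions. -/
theorem hoppingForm_one_eq_sum_dirWeight :
    hoppingForm Gᴸ (fun _ _ => (1 : ℝ)) = hoppingForm Gᴸ (dirWeight 0) + hoppingForm Gᴸ (dirWeight 1) := by
  rw [hoppingForm_add]
  refine hoppingForm_congr_adj Gᴸ fun u v h => ?_
  have hs := sum_dirWeight_of_adj h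
  rw [Fin.sum_univ_two] at hs
  exact hs.symm

omit [NeZero L] in
/-- The direction hopping forms are Hermitian. -/
theorem isHermitian_hoppingForm_dirWeight (j : Fin 2) : (hoppingForm Gᴸ (dirWeight j)).IsHermitian :=
  isHermitian_hoppingForm Gᴸ fun u v => dirWeight_symm j u v

/-! ### Gauge invariance of the other direction and of the density terms -/

omit [NeZero L] in
/-- A site potential depending only on coordinate `j` leaves the direction-`k` hopping form
invariant for `k ≠ j` (its bonds stay inside a coordinate-`j` class). -/
theorem siteGauge_conj_hoppingForm_dirWeight_of_ne {j k : Fin 2} (hkj : k ≠ j) (f : ZMod L → ℝ) :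
    siteGauge (fun z : FermionTorus 2 L => f (z.toTorusSite j)) * hoppingForm Gᴸ (dirWeight k) *
        siteGauge (-fun z : FermionTorus 2 L => f (z.toTorusSite j)) =
      hoppingForm Gᴸ (dirWeight k) := by
  rw [siteGauge_mul_hoppingForm_mul]
  congr 1
  funext u v
  rcases dirWeight_eq_zero_or_one k u v with h | h
  · rw [h, zero_mul]
  · have huv := (ne_and_eq_of_dirWeight_ne_zero (j := k) (u := u) (v := v) (by rw [h]; exact one_ne_zero)).2
      j (Ne.symm hkj)
    rw [huv, sub_self, Real.exp_zero, mul_one]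

omit [NeZero L] in
/-- The "rest" Hamiltonian `A_j = -t T(1_{dir (1-j)}) + U D - μ N` (everything but the direction-`j`
hopping) is invariant under any site gauge depending only on coordinate `j`. -/
theorem siteGauge_conj_rest_eq {j k : Fin 2} (hkj : k ≠ j) (f : ZMod L → ℝ) (t U μ : ℝ) :
    siteGauge (fun z : FermionTorus 2 L => f (z.toTorusSite j)) *
        (-(t : ℂ) • hoppingForm Gᴸ (dirWeight k) + densityTerms U μ) *
        siteGauge (-fun z : FermionTorus 2 L => f (z.toTorusSite j)) =
      -(t : ℂ) • hoppingForm Gᴸ (dirWeight k) + densityTerms U μ := by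
  rw [Matrix.mul_add, Matrix.add_mul, Matrix.mul_smul, Matrix.smul_mul,
    siteGauge_conj_hoppingForm_dirWeight_of_ne hkj f, siteGauge_mul_densityTerms_mul]

omit [NeZero L] in
/-- **Each bond term of `T_j` is a gauge eigenvector with eigenvalue `e^{-1}`** under the site gauge of
the indicator of the coordinate-`j` class of its creation site. -/
theorem siteGauge_conj_bondTerm (j : Fin 2) {u v : FermionTorus 2 L}
    (huv : u.toTorusSite j ≠ v.toTorusSite j) (σ : Fin 2) :
    siteGauge (fun z : FermionTorus 2 L => if z.toTorusSite j = u.toTorusSite j then (1 : ℝ) else 0) *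
        (creation (orb u σ) * annihilation (orb v σ)) *
        siteGauge (-fun z : FermionTorus 2 L => if z.toTorusSite j = u.toTorusSite j then (1 : ℝ) else 0) =
      ((Real.exp (-1) : ℝ) : ℂ) • (creation (orb u σ) * annihilation (orb v σ)) := by
  rw [siteGauge_conj_mul, siteGauge_mul_creation_mul, siteGauge_mul_annihilation_mul, smul_mul_smul,
    if_pos rfl, if_neg (Ne.symm huv), Real.exp_zero, Complex.ofReal_one, mul_one]

/-! ### Directional kinetic positivity -/

omit [NeZero L] in
/-- The Hubbard Hamiltonian splits as `H = A_j + W_j`, `W_j = -t T(1_{dir j})`,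
`A_j = -t T(1_{dir k}) + U D - μ N` (`k ≠ j`). -/
theorem hamiltonianWith_eq_rest_add_dir {j k : Fin 2} (hkj : k ≠ j) (t U μ : ℝ) :
    hamiltonianWith Gᴸ t U μ =
      (-(t : ℂ) • hoppingForm Gᴸ (dirWeight k) + densityTerms U μ) +
        -(t : ℂ) • hoppingForm Gᴸ (dirWeight j) := by
  rw [hamiltonianWith_eq_hoppingForm, hoppingForm_one_eq_sum_dirWeight]
  have hjk : (j = 0 ∧ k = 1) ∨ (j = 1 ∧ k = 0) := by omega
  rcases hjk with ⟨rfl, rfl⟩ | ⟨rfl, rfl⟩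
  · rw [smul_add]; abel
  · rw [smul_add]; abel

omit [NeZero L] in
/-- **`tr (e^{-β A_j|_p} T_j|_p) = 0`**: in the Gibbs state of the "rest" Hamiltonian (no direction-`j`
hopping) every direction-`j` bond term has vanishing expectation, in ANY principal block `p`. -/
theorem trace_gibbsWeight_rest_mul_dirHopping_toBlock {j k : Fin 2} (hkj : k ≠ j) (t U μ β : ℝ)
    (p : Finset (Orb (FermionTorus 2 L)) → Prop) [DecidablePred p] :
    trace (gibbsWeight β ((-(t : ℂ) • hoppingForm Gᴸ (dirWeight k) + densityTerms U μ).toBlock p p) *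
      (hoppingForm Gᴸ (dirWeight j)).toBlock p p) = 0 := by
  set A := -(t : ℂ) • hoppingForm Gᴸ (dirWeight k) + densityTerms U μ with hA
  -- expand `T_j|_p` into bond terms; `toBlock` and `trace (E * ·)` are additive
  have hlin : ∀ X Y : Matrix (Finset (Orb (FermionTorus 2 L))) (Finset (Orb (FermionTorus 2 L))) ℂ,
      (X + Y).toBlock p p = X.toBlock p p + Y.toBlock p p := fun _ _ => rfl
  let Φ : Matrix (Finset (Orb (FermionTorus 2 L))) (Finset (Orb (FermionTorus 2 L))) ℂ →+ ℂ :=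
    { toFun := fun X => trace (gibbsWeight β (A.toBlock p p) * X.toBlock p p)
      map_zero' := by simp [Matrix.toBlock]
      map_add' := fun X Y => by rw [hlin X Y, Matrix.mul_add, trace_add] }
  have hΦ : ∀ X, trace (gibbsWeight β (A.toBlock p p) * X.toBlock p p) = Φ X := fun _ => rfl
  rw [hΦ, hoppingForm_eq, map_sum]
  refine Finset.sum_eq_zero fun u _ => ?_
  rw [map_sum]
  refine Finset.sum_eq_zero fun v _ => ?_
  rw [map_sum]
  refine Finset.sum_eq_zero fun σ _ => ?_
  by_cases huv : (Gᴸ).Adj u v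
  · rw [if_pos huv]
    rcases dirWeight_eq_zero_or_one j u v with h0 | h1
    · rw [h0, Complex.ofReal_zero, zero_smul, map_zero]
    · have hne := (ne_and_eq_of_dirWeight_ne_zero (j := j) (u := u) (v := v)
        (by rw [h1]; exact one_ne_zero)).1
      rw [h1, Complex.ofReal_one, one_smul, ← hΦ]
      -- the gauge: indicator of the coordinate-`j` class of `u`
      set f : ZMod L → ℝ := fun c => if c = u.toTorusSite j then 1 else 0 with hf
      set φ : FermionTorus 2 L → ℝ := fun z => f (z.toTorusSite j) with hφ
      have hS1 := siteGauge_neg_mul_siteGauge φ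
      have hSA : siteGauge φ * A * siteGauge (-φ) = A := siteGauge_conj_rest_eq hkj f t U μ
      have hSAc : siteGauge φ * A = A * siteGauge φ := mul_eq_mul_of_conj_eq hS1 hSA
      have hX : siteGauge φ * (creation (orb u σ) * annihilation (orb v σ)) * siteGauge (-φ) =
          ((Real.exp (-1) : ℝ) : ℂ) • (creation (orb u σ) * annihilation (orb v σ)) :=
        siteGauge_conj_bondTerm j hne σ
      -- pass to the block: the gauge is diagonal, so its conjugation commutes with compression
      have hoff : ∀ (ψ : FermionTorus 2 L → ℝ) (i : Finset (Orb (FermionTorus 2 L))), p i →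
          ∀ i', ¬p i' → siteGauge ψ i i' = 0 :=
        fun ψ i hi i' hi' => siteGauge_apply_ne ψ (by rintro rfl; exact hi' hi)
      have hoff' : ∀ (ψ : FermionTorus 2 L → ℝ) (i : Finset (Orb (FermionTorus 2 L))), ¬p i →
          ∀ i', p i' → siteGauge ψ i i' = 0 :=
        fun ψ i hi i' hi' => siteGauge_apply_ne ψ (by rintro rfl; exact hi hi')
      -- `S̃' S̃ = 1` on the block (the identity for the gauge file's decidability instance)
      have hS1' := toBlock_mul_toBlock_eq_one p hS1 (hoff (-φ))
      have hc : (siteGauge φ).toBlock p p * A.toBlock p p = A.toBlock p p * (siteGauge φ).toBlock p p := by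
        rw [← toBlock_mul_eq_of_upperRight p _ (hoff φ), ← toBlock_mul_eq_of_lowerLeft p _ (hoff' φ),
          hSAc]
      have hEc : (siteGauge φ).toBlock p p * gibbsWeight β (A.toBlock p p) =
          gibbsWeight β (A.toBlock p p) * (siteGauge φ).toBlock p p := mul_gibbsWeight_comm hc β
      have hX' : (siteGauge φ).toBlock p p * (creation (orb u σ) * annihilation (orb v σ)).toBlock p p *
          (siteGauge (-φ)).toBlock p p =
          ((Real.exp (-1) : ℝ) : ℂ) • (creation (orb u σ) * annihilation (orb v σ)).toBlock p p := by
        rw [← toBlock_mul_eq_of_upperRight p _ (hoff φ), ← toBlock_mul_eq_of_lowerLeft p _ (hoff' (-φ)),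
          hX]
        rfl
      refine trace_mul_eq_zero_of_conj_eq_smul hS1' hEc hX' ?_
      rw [Ne, Complex.ofReal_eq_one, Real.exp_eq_one_iff]; norm_num
  · rw [if_neg huv, map_zero]

omit [NeZero L] in
/-- **Prop. 11.5 (directional kinetic positivity in a sector).** For the nearest-neighbour Hubbard
Hamiltonian `H = -t T(1) + U D - μ N` on the torus `(ℤ/L)²`, any real `t`, `β > 0`, and ANY principal
block `p` (e.g. an `(N↑, N↓)` sector): `0 ≤ t · Re ⟨T(1_{dir j})|_p⟩_{β, H|_p}` for each direction `j`
(for `t > 0`: the kinetic energy of each bond direction is separately non-positive).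
[Bogoliubov convexity twice + vanishing in the direction-`j`-free Gibbs state by the site gauge.] -/
theorem re_gibbsState_dirHopping_toBlock_nonneg (j : Fin 2) (t U μ : ℝ) {β : ℝ}
    (hβ : 0 < β) (p : Finset (Orb (FermionTorus 2 L)) → Prop) [DecidablePred p] [Nonempty {s // p s}] :
    0 ≤ t * (gibbsState β ((hamiltonianWith Gᴸ t U μ).toBlock p p)
      ((hoppingForm Gᴸ (dirWeight j)).toBlock p p)).re := by
  obtain ⟨k, hkj⟩ : ∃ k : Fin 2, k ≠ j := ⟨j + 1, by omega⟩
  set A := -(t : ℂ) • hoppingForm Gᴸ (dirWeight k) + densityTerms U μ with hA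
  set W := -(t : ℂ) • hoppingForm Gᴸ (dirWeight j) with hW
  have hHsplit : (hamiltonianWith Gᴸ t U μ).toBlock p p = A.toBlock p p + W.toBlock p p := by
    rw [hamiltonianWith_eq_rest_add_dir hkj]; rfl
  have hWh : W.IsHermitian := by
    have h := (isHermitian_hoppingForm_dirWeight (L := L) j).eq
    rw [hW, IsHermitian, conjTranspose_smul, h]
    simp only [Complex.star_def, map_neg, Complex.conj_ofReal]
  have hAh : A.IsHermitian := by
    refine IsHermitian.add ?_ (isHermitian_densityTerms U μ)
    have h := (isHermitian_hoppingForm_dirWeight (L := L) k).eq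
    rw [IsHermitian, conjTranspose_smul, h]
    simp only [Complex.star_def, map_neg, Complex.conj_ofReal]
  have hmono := re_gibbsState_add_le (hAh.submatrix (fun s : {s // p s} => (s : Finset _)))
    (hWh.submatrix (fun s : {s // p s} => (s : Finset _))) hβ
  have hzero : gibbsState β (A.toBlock p p) (W.toBlock p p) = 0 := by
    rw [gibbsState_apply, show W.toBlock p p = -(t : ℂ) • (hoppingForm Gᴸ (dirWeight j)).toBlock p p
      from rfl, Matrix.mul_smul, trace_smul, trace_gibbsWeight_rest_mul_dirHopping_toBlock hkj t U μ β p,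
      smul_zero, mul_zero]
  have h1 : (gibbsState β ((hamiltonianWith Gᴸ t U μ).toBlock p p) (W.toBlock p p)).re ≤ 0 := by
    rw [hHsplit]
    refine (le_of_le_of_eq hmono ?_)
    change (gibbsState β (Matrix.toBlock A p p) (Matrix.toBlock W p p)).re = 0
    rw [hzero, Complex.zero_re]
  rw [show W.toBlock p p = -(t : ℂ) • (hoppingForm Gᴸ (dirWeight j)).toBlock p p from rfl, map_smul,
    smul_eq_mul, neg_mul, Complex.neg_re, Complex.re_ofReal_mul, neg_nonpos] at h1
  exact h1

/-! ### Node forms -/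

/-- **Prop. 11.5 (directional kinetic positivity), node form.** For every `L ≥ 1`, direction `j`,
real `t, U, μ`, `β > 0` and every principal block `p` of the Fock space of the torus `(ℤ/L)²` with
`p` non-empty: `0 ≤ t · Re⟨T(1_{dir j})|_p⟩_{β, H(t,U,μ)|_p}`. kind: support (PROVED). Why it might fail:
it cannot (Bogoliubov convexity + gauge covariance); content: replaces the translation/rotation
symmetry step of KuboKishi1990 (proof of Thm 1) in sectors. Sources: KuboKishi1990 Thm 1 (proof);
KomaTasakiPRL1992 eqs. (5)–(8); DLS1978 §2; this cell (bounds.tex Prop. 11.5). -/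
@[conjecture] def DirectionalKineticPositivity : Prop :=
  ∀ (L : ℕ) (j : Fin 2) (t U μ β : ℝ), 0 < β →
    ∀ (p : Finset (Orb (FermionTorus 2 L)) → Prop) [DecidablePred p], Nonempty {s // p s} →
      0 ≤ t * (gibbsState β ((hamiltonianWith (fermionTorusGraph 2 L) t U μ).toBlock p p)
        ((hoppingForm (fermionTorusGraph 2 L) (dirWeight j)).toBlock p p)).re

/-- **`DirectionalKineticPositivity` holds.** -/
theorem directionalKineticPositivity_holds : DirectionalKineticPositivity := by
  intro L j t U μ β hβ p _ hne
  haveI := hne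
  exact re_gibbsState_dirHopping_toBlock_nonneg j t U μ hβ p

end Torus

end Summit.HubbardSuperconductivity.HubbardLadder.Bounds
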